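import Summits.NavierStokesRegularity.NavierStokesRegularity.Theorems.FilamentSkeletonRssSkeletonJ1RSplit
import Summits.NavierStokesRegularity.NavierStokesRegularity.Theorems.FilamentSkeletonRssNormalBlockMatchedL
import Summits.NavierStokesRegularity.NavierStokesRegularity.Theorems.FilamentSkeletonRssClause13RImp

/-!
# Route `FilamentSkeletonRss` · crux `SkeletonJ1R` (stmt-NavierStokesRegularity-23610) · LINE `switchoff_degree_R` — DEFINITION SANITY LEMMAS
# (crux-strategist r1, generation 2, 2026-08-29: second-opinion audit of the registered skeleton `Lines/switchoff_degree_R.lean`, sha 45b2ee91d7d0)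

WHAT THIS FILE IS.  The §1–§2 definitions of the registered line `switchoff_degree_R` (skeleton of record on the crux item, registered
2026-08-29T03:59Z) COPIED VERBATIM (the `Lines/*.lean` workfiles are not built modules, so they cannot be imported), followed by eight
sorry-free SANITY LEMMAS that pin down the sign / normalisation conventions the line's stubs silently rely on:

* `switchWeight_zero`            — at homotopy time `s = 0` the switch weight is identically `0` (the switched field IS the outer model:
                                    `switchedField_zero_eq_outer`), so the Leray–Schauder homotopy starts at the X-INDEPENDENT model problem;
* `switchWeight_one_of_mem_ball`  — at `s = 1` the weight is `1` on the crux ball `‖y‖ ≤ ℓ`, `ℓ = Rb√(Γ log Γ)`, hence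
  `switchedField_eq_trueField_on_ball`: at the end of the homotopy a switched-tangent skeleton is EXACTLY tangent to the crux's true
  rotating-frame field on the crux ball (this is what `stub_flatOutput` needs for clause 9 of `FlatJ1L`);
* `switchWeight_zero_of_far`      — at `s = 1` the weight vanishes for `‖y‖² ≥ 2ℓ²`: the far arms are governed by the outer model alone;
* `perpTo_axis`, `tubeWeight_axis`, `armModel_axis` — on the datum line `waistPt j + τ • t j` the normal projection vanishes, the tube
  weight is `1` and the arm model is the pure stretching `(7/4) τ • t j` (unique zero at the waist point, unstable direction `t j`), i.e.
  the datum lines ARE streamlines of the time-0 problem through hyperbolic zeros — the base point of the index computation.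

All eight elaborate with no `sorry` (strategist probe run, `lean check` rc 0 on this file).  The COSTUME / SHREDDING probes of the audit
(`stub ↛ crux`, `stub ↛ child TangentSkeletonNearStraightL`, `stub` not closable by `exact?`/`aesop`, `¬stub` not closable) were run in the
strategist's scratch files and are reported in `AUDIT-r1g2.md` (they fail to close, as they must; failing probes are not publishable Lean).

MODEL rung, NEGATIVE side of the ladder: bookkeeping about a HYPOTHETICAL filament-type rotating-self-similar blow-up skeleton; nothing here
proves or refutes any statement about Navier–Stokes regularity. [folklore]
-/

set_option linter.dupNamespace false
set_option linter.unusedVariables false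

noncomputable section

namespace Summit.NavierStokesRegularity.NavierStokesRegularity.Cruxes.SkeletonJ1R.SwitchoffDegreeRSanity

open Set Function Filter MeasureTheory Real
open Literature.Analysis.FluidPDE
open Summit.NavierStokesRegularity.NavierStokesRegularity.Theses.FilamentSkeletonRss
open Summit.NavierStokesRegularity.NavierStokesRegularity.Theorems.FilamentSkeletonRssSkeletonJ1GSplit
  (NearStraightJ1G StraightDatum straightDatumGP_exists)
open Summit.NavierStokesRegularity.NavierStokesRegularity.Theorems.FilamentSkeletonRssSkeletonJ1LSplit
  (FlatJ1L TangentSkeletonNearStraightLS route_tangentSkeletonNearStraightL_iff)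
open scoped InnerProductSpace Topology BigOperators

/-! ## §1 The switched problem (concrete definitions) -/

/-- The crux's regularised Biot–Savart field with RIGID UNIT CORES (`Aa ≡ 1`): the `u` of `FlatJ1L`'s hypothesis `hu` at `Aa k σ = 1`. -/
def bsField {N : ℕ} (Γ : ℝ) (γ : Fin N → ℝ) (Z : Fin N → ℝ → EuclideanSpace ℝ (Fin 3)) (y : EuclideanSpace ℝ (Fin 3)) :
    EuclideanSpace ℝ (Fin 3) :=
  ∑ k, (Γ*γ k/(4*Real.pi)) • ∫ σ:ℝ, ((‖y-Z k σ‖^2+Real.exp (-(1+Real.eulerMascheroniConstant-Real.log 2))*(1:ℝ))^(3/2:ℝ))⁻¹ •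
    cross (deriv (Z k) σ) (y-Z k σ)

/-- The TRUE rotating-frame field of the crux (hypothesis `hv` of `FlatJ1L`): `u_X y + ½ y − α e₃ × y`. -/
def trueField {N : ℕ} (Γ : ℝ) (γ : Fin N → ℝ) (α : ℝ) (X : Fin N → ℝ → EuclideanSpace ℝ (Fin 3)) (y : EuclideanSpace ℝ (Fin 3)) :
    EuclideanSpace ℝ (Fin 3) :=
  bsField Γ γ X y + (1/2:ℝ) • y - α • cross (EuclideanSpace.single 2 1) y

/-- Smooth switch profile: `= 1` on `(-∞, 0]`, `= 0` on `[1, ∞)`, values in `[0,1]` (Mathlib's `Real.smoothTransition`, reflected). -/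
def switchProfile (x : ℝ) : ℝ := Real.smoothTransition (1 - x)

/-- Switch weight at homotopy time `s`: `χ(‖y‖²/ℓ² + 1 − 2s)` (smooth in `y`, squared norm) — identically `0` at `s = 0`; at `s = 1` it is `1` on
`‖y‖ ≤ ℓ` and `0` on `‖y‖ ≥ √2·ℓ`; in between the true field is switched on in the ball `‖y‖² ≤ (2s−1)ℓ²` with a collar out to `‖y‖² = 2sℓ²`. -/
def switchWeight (ℓ s : ℝ) (y : EuclideanSpace ℝ (Fin 3)) : ℝ := switchProfile (‖y‖ ^ 2 / ℓ ^ 2 + 1 - 2 * s)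

/-- Scaled datum waist point `√Γ • (p j + s₀ j • t j)`. -/
def waistPt {N : ℕ} (Γ : ℝ) (p t : Fin N → EuclideanSpace ℝ (Fin 3)) (s₀ : Fin N → ℝ) (j : Fin N) : EuclideanSpace ℝ (Fin 3) :=
  Real.sqrt Γ • (p j + s₀ j • t j)

/-- Component of `z` normal to the unit vector `t j`. -/
def perpTo {N : ℕ} (t : Fin N → EuclideanSpace ℝ (Fin 3)) (j : Fin N) (z : EuclideanSpace ℝ (Fin 3)) : EuclideanSpace ℝ (Fin 3) :=
  z - ⟪z, t j⟫_ℝ • t j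

/-- Tube weight about datum line `j` (radius `R`): `1` where `‖(y − Pw j)⊥‖² ≤ R²`, `0` where `≥ 2R²`, smooth. -/
def tubeWeight {N : ℕ} (Γ R : ℝ) (p t : Fin N → EuclideanSpace ℝ (Fin 3)) (s₀ : Fin N → ℝ) (j : Fin N) (y : EuclideanSpace ℝ (Fin 3)) : ℝ :=
  Real.smoothTransition (2 - ‖perpTo t j (y - waistPt Γ p t s₀ j)‖ ^ 2 / R ^ 2)

/-- The linear hyperbolic model field of arm `j`: axial rate `7/4` along `t j` from the waist, normal contraction rate `λ` onto the datum line. -/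
def armModel {N : ℕ} (Γ lam : ℝ) (p t : Fin N → EuclideanSpace ℝ (Fin 3)) (s₀ : Fin N → ℝ) (j : Fin N) (y : EuclideanSpace ℝ (Fin 3)) :
    EuclideanSpace ℝ (Fin 3) :=
  ((7/4:ℝ) * ⟪y - waistPt Γ p t s₀ j, t j⟫_ℝ) • t j - lam • perpTo t j (y - waistPt Γ p t s₀ j)

/-- The X-INDEPENDENT outer model field: arm models inside the (pairwise disjoint) tubes of radius `R = ρ√Γ/4`, `½ y` outside. -/
def outerModel {N : ℕ} (Γ ρ lam : ℝ) (p t : Fin N → EuclideanSpace ℝ (Fin 3)) (s₀ : Fin N → ℝ) (y : EuclideanSpace ℝ (Fin 3)) :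
    EuclideanSpace ℝ (Fin 3) :=
  (∑ j, tubeWeight Γ (ρ * Real.sqrt Γ / 4) p t s₀ j y • armModel Γ lam p t s₀ j y) +
    (1 - ∑ j, tubeWeight Γ (ρ * Real.sqrt Γ / 4) p t s₀ j y) • (1/2:ℝ) • y

/-- THE SWITCHED FIELD at homotopy time `s` generated by the skeleton `X` ITSELF (self-consistent at every `s`):
`σ • trueField X y + (1 − σ) • outerModel y`, `σ = switchWeight (Rb√(Γ log Γ)) s y`. -/
def switchedField {N : ℕ} (Γ ρ lam Rb : ℝ) (p t : Fin N → EuclideanSpace ℝ (Fin 3)) (γ : Fin N → ℝ) (α : ℝ) (s₀ : Fin N → ℝ)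
    (s : ℝ) (X : Fin N → ℝ → EuclideanSpace ℝ (Fin 3)) (y : EuclideanSpace ℝ (Fin 3)) : EuclideanSpace ℝ (Fin 3) :=
  switchWeight (Rb * Real.sqrt (Γ * Real.log Γ)) s y • trueField Γ γ α X y +
    (1 - switchWeight (Rb * Real.sqrt (Γ * Real.log Γ)) s y) • outerModel Γ ρ lam p t s₀ y

/-- SWITCHED-TANGENT SKELETON at time `s`: unit-speed `C²` curves, each GLOBALLY tangent to the switched field it generates, through a zero of
that field at parameter `0` (the waist), switched slip `≤ 0` before and `≥ 0` after the waist (closed conditions; with `RegularWaist` the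
curve is the oriented unstable streamline of its waist zero), escaping to infinity. -/
def SwitchedTangent {N : ℕ} (Γ ρ lam Rb : ℝ) (p t : Fin N → EuclideanSpace ℝ (Fin 3)) (γ : Fin N → ℝ) (α : ℝ) (s₀ : Fin N → ℝ)
    (s : ℝ) (X : Fin N → ℝ → EuclideanSpace ℝ (Fin 3)) : Prop :=
  ∀ j, ContDiff ℝ 2 (X j) ∧ (∀ τ, ‖deriv (X j) τ‖ = 1) ∧
    (∀ τ, switchedField Γ ρ lam Rb p t γ α s₀ s X (X j τ) =
      ⟪switchedField Γ ρ lam Rb p t γ α s₀ s X (X j τ), deriv (X j) τ⟫_ℝ • deriv (X j) τ) ∧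
    switchedField Γ ρ lam Rb p t γ α s₀ s X (X j 0) = 0 ∧
    (∀ τ, 0 ≤ τ → 0 ≤ ⟪switchedField Γ ρ lam Rb p t γ α s₀ s X (X j τ), deriv (X j) τ⟫_ℝ) ∧
    (∀ τ, τ ≤ 0 → ⟪switchedField Γ ρ lam Rb p t γ α s₀ s X (X j τ), deriv (X j) τ⟫_ℝ ≤ 0) ∧
    Tendsto (fun τ => ‖X j τ‖) (cocompact ℝ) atTop

/-- COARSE near-straight class about the scaled datum (tilt `≤ Rb/2`, inside the half-tubes, waist within `ρ√Γ/8` of the datum waist). -/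
def CoarseClass {N : ℕ} (Γ ρ Rb : ℝ) (p t : Fin N → EuclideanSpace ℝ (Fin 3)) (s₀ : Fin N → ℝ)
    (X : Fin N → ℝ → EuclideanSpace ℝ (Fin 3)) : Prop :=
  ∀ j, (∀ τ, ‖deriv (X j) τ - t j‖ ≤ Rb / 2) ∧ (∀ τ, ‖perpTo t j (X j τ - waistPt Γ p t s₀ j)‖ ≤ ρ * Real.sqrt Γ / 8) ∧
    ‖X j 0 - waistPt Γ p t s₀ j‖ ≤ ρ * Real.sqrt Γ / 8

/-- FINE class (the a priori bounds): tilt `≤ Rb/4`, offsets and waist displacement `≤ Rb√Γ`, curvature `≤ Rb/√Γ`, and the TRUE slip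
`w = ⟪trueField X (X j τ), X j′ τ⟫` has slope in `[3/2 + δ/2, Λ + 1]` at the waist and `|w′| ≤ Λ + 1` everywhere. -/
def FineClass {N : ℕ} (Γ δ Λ Rb : ℝ) (p t : Fin N → EuclideanSpace ℝ (Fin 3)) (γ : Fin N → ℝ) (α : ℝ) (s₀ : Fin N → ℝ)
    (X : Fin N → ℝ → EuclideanSpace ℝ (Fin 3)) : Prop :=
  ∀ j, (∀ τ, ‖deriv (X j) τ - t j‖ ≤ Rb / 4) ∧ (∀ τ, ‖perpTo t j (X j τ - waistPt Γ p t s₀ j)‖ ≤ Rb * Real.sqrt Γ) ∧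
    ‖X j 0 - waistPt Γ p t s₀ j‖ ≤ Rb * Real.sqrt Γ ∧ (∀ τ, ‖iteratedDeriv 2 (X j) τ‖ * Real.sqrt Γ ≤ Rb) ∧
    Differentiable ℝ (fun τ => ⟪trueField Γ γ α X (X j τ), deriv (X j) τ⟫_ℝ) ∧
    3/2 + δ/2 ≤ deriv (fun τ => ⟪trueField Γ γ α X (X j τ), deriv (X j) τ⟫_ℝ) 0 ∧
    (∀ τ, |deriv (fun τ => ⟪trueField Γ γ α X (X j τ), deriv (X j) τ⟫_ℝ) τ| ≤ Λ + 1)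

/-- REGULAR WAIST at time `s`: in the waist box of radius `ρ√Γ/4` the switched field vanishes ONLY at `X j 0`, the switched slip along `X j`
vanishes ONLY at `τ = 0`, and the derivative of the switched field at the waist has `X j′ 0` as an eigenvector with positive eigenvalue and a
normal block of negative trace and positive determinant (saddle-focus, the clause-12 shape of the landed `NormalBlockMatchedL`). -/
def RegularWaist {N : ℕ} (Γ ρ lam Rb : ℝ) (p t : Fin N → EuclideanSpace ℝ (Fin 3)) (γ : Fin N → ℝ) (α : ℝ) (s₀ : Fin N → ℝ)
    (s : ℝ) (X : Fin N → ℝ → EuclideanSpace ℝ (Fin 3)) : Prop :=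
  ∀ j, (∀ y, ‖y - waistPt Γ p t s₀ j‖ ≤ ρ * Real.sqrt Γ / 4 → switchedField Γ ρ lam Rb p t γ α s₀ s X y = 0 → y = X j 0) ∧
    (∀ τ, ⟪switchedField Γ ρ lam Rb p t γ α s₀ s X (X j τ), deriv (X j) τ⟫_ℝ = 0 → τ = 0) ∧
    ∃ (A : EuclideanSpace ℝ (Fin 3) →L[ℝ] EuclideanSpace ℝ (Fin 3)) (m n : EuclideanSpace ℝ (Fin 3)),
      A = fderiv ℝ (switchedField Γ ρ lam Rb p t γ α s₀ s X) (X j 0) ∧ Orthonormal ℝ ![deriv (X j) 0, m, n] ∧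
      A (deriv (X j) 0) = ⟪A (deriv (X j) 0), deriv (X j) 0⟫_ℝ • deriv (X j) 0 ∧ 0 < ⟪A (deriv (X j) 0), deriv (X j) 0⟫_ℝ ∧
      ⟪A m, m⟫_ℝ + ⟪A n, n⟫_ℝ < 0 ∧ ⟪A n, m⟫_ℝ * ⟪A m, n⟫_ℝ < ⟪A m, m⟫_ℝ * ⟪A n, n⟫_ℝ


/-! ## §2 The stub STATEMENTS of the registered line (named `Prop`s, copied verbatim; asserted by the stubs of `Lines/switchoff_degree_R.lean`, NOT here) -/

/-- STUB C statement · A PRIORI CONFINEMENT (XL — THE HARD STUB).  For every general-position straight datum there are a contraction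
rate `λ` and a tolerance ceiling `Rb₁` such that for every `Rb ≤ Rb₁` and all `Γ ≥ Γ₂(Rb)`, UNIFORMLY IN THE HOMOTOPY TIME `s ∈ [0,1]`:
every switched-tangent skeleton in the COARSE class lies in the FINE class and has REGULAR waists.  Content (line card §Stubs): (i) smooth-
scale confinement by bending dominance in the velocity-DEFECT formulation (affine block ~ strain `O(1)`, bending-band gain `8πRb²/γ`);
(ii) RIPPLE EXCLUSION for the shell band `kμ ≈ κ*`: each circular polarisation is transported ONE WAY at group speed `≍ Γ/μ ≫ |w|`,
its incoming data vanish because beyond the switch both arms are exact `outerModel` streamlines, band sources are exponentially small in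
`μ/ℓ` and `μ/(ρ√Γ)` (coefficients vary on scales `ℓ`, `ρ√Γ` only), and the only feedback loop (exit collar ↦ inward bending-band
disturbance ↦ waist ↦ re-emission) has exponentially small gain — an INJECTIVITY estimate, no inverse taken; (iii) collar slaving:
with the self-induction weight `σ → 0` the tilt precesses neutrally (the offset from the datum line is conserved to leading order and FREE,
since every line parallel to `t j` is an `outerModel` streamline) and is slaved to `O(σ)` at the outer edge; (iv) waist regularity: swirl
pinning + the saddle-focus normal block (the mechanism of the landed `NormalBlockMatchedL`), for the mixed field at every `s`. -/
def Confinement : Prop :=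
  ∀ (N : ℕ) (δd ρd Λd Rwd θd mw : ℝ) (p t : Fin N → EuclideanSpace ℝ (Fin 3)) (γ : Fin N → ℝ) (α : ℝ) (s₀ : Fin N → ℝ),
    0 < N → 0 < δd → 0 < ρd → 0 < Rwd → 0 < θd → 0 < mw → StraightDatum N δd ρd Λd Rwd θd mw p t γ α s₀ →
    (∀ j k, j ≠ k → |⟪t j, t k⟫_ℝ| ≤ 1 - θd) →
    ∃ (lam Rb₁ : ℝ), 0 < lam ∧ 0 < Rb₁ ∧ ∀ Rb : ℝ, 0 < Rb → Rb ≤ Rb₁ → ∃ Γ₂ : ℝ, ∀ Γ : ℝ, Γ₂ ≤ Γ →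
      ∀ s : ℝ, 0 ≤ s → s ≤ 1 → ∀ X : Fin N → ℝ → EuclideanSpace ℝ (Fin 3),
        CoarseClass Γ ρd Rb p t s₀ X → SwitchedTangent Γ ρd lam Rb p t γ α s₀ s X →
          FineClass Γ δd Λd Rb p t γ α s₀ X ∧ RegularWaist Γ ρd lam Rb p t γ α s₀ s X

/-- STUB B statement · THE LERAY–SCHAUDER ALTERNATIVE FOR THE INFLATING SWITCH-ON (L; classical functional analysis, Mathlib has no
Leray–Schauder degree).  At FIXED `Γ` (large) and fixed `λ, Rb`: if, for every homotopy time `s ∈ [0,1]`, every switched-tangent skeleton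
in the coarse class is fine with regular waists, then a fine switched-tangent skeleton with regular waists EXISTS at `s = 1`.  Content:
ambient space `E` = `C¹_b` perturbations of the scaled datum lines; open sets `U_s ⊂ E` (geometric tolerances strictly between FINE and
COARSE, plus: the switched field has exactly one zero in each waist box and it is hyperbolic of type (1 unstable, 2 stable) — an open
condition); the map `Φ^s(X)` = arclength parametrisation from the waist zero of its global UNSTABLE STREAMLINE — compact (integral curves of
`C^∞` fields, `Γ`-dependent bounds suffice), continuous in `(s, X)`, CONSTANT `= datum` for `s` near `0` (switch weight `≡ 0`: the field is
`outerModel`, whose unstable streamlines are the datum lines), and `Fix Φ^s ∩ U_s` = the switched-tangent skeletons in `U_s`; the hypothesis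
makes the parametrised fixed-point set compact in `⋃_s {s} × U_s`, so the fixed-point index is constant `= 1` (Granas–Dugundji §12; Leray–
Schauder 1934; Schaefer 1955). -/
def LeraySchauderSwitchOn : Prop :=
  ∀ (N : ℕ) (δd ρd Λd Rwd θd mw : ℝ) (p t : Fin N → EuclideanSpace ℝ (Fin 3)) (γ : Fin N → ℝ) (α : ℝ) (s₀ : Fin N → ℝ),
    0 < N → 0 < δd → 0 < ρd → 0 < Rwd → 0 < θd → 0 < mw → StraightDatum N δd ρd Λd Rwd θd mw p t γ α s₀ →
    (∀ j k, j ≠ k → |⟪t j, t k⟫_ℝ| ≤ 1 - θd) →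
    ∀ lam Rb : ℝ, 0 < lam → 0 < Rb → Rb ≤ ρd / 16 → ∃ Γ₁ : ℝ, ∀ Γ : ℝ, Γ₁ ≤ Γ →
      (∀ s : ℝ, 0 ≤ s → s ≤ 1 → ∀ X : Fin N → ℝ → EuclideanSpace ℝ (Fin 3),
        CoarseClass Γ ρd Rb p t s₀ X → SwitchedTangent Γ ρd lam Rb p t γ α s₀ s X →
          FineClass Γ δd Λd Rb p t γ α s₀ X ∧ RegularWaist Γ ρd lam Rb p t γ α s₀ s X) →
      ∃ X : Fin N → ℝ → EuclideanSpace ℝ (Fin 3),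
        FineClass Γ δd Λd Rb p t γ α s₀ X ∧ SwitchedTangent Γ ρd lam Rb p t γ α s₀ 1 X ∧ RegularWaist Γ ρd lam Rb p t γ α s₀ 1 X

/-- STUB D statement · FLAT OUTPUT (M; bookkeeping + one far-field estimate).  A FINE switched-tangent skeleton at `s = 1` with regular
waists satisfies the flat clause block `FlatJ1L` and the near-straight regime `NearStraightJ1G` with `c := 0`, rigid unit cores `Aa := 1`
(`KA := 1`), `w :=` the TRUE slip `⟪trueField X (X j τ), X j′ τ⟫`, and datum-derived constants: on the crux ball `‖y‖ ≤ Rb√(Γ log Γ)` the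
switch weight is `1`, so global switched tangency IS clause 9; the unique zero of the TRUE slip needs `½⟪X, X′⟫ > |α|·|⟪e₃ × X, X′⟫| + |⟪u_X, X′⟫|`
off the ball (a Biot–Savart size estimate `|u_X(X j τ)| ≤ C√Γ log Γ` along near-straight separated skeletons); separation / chord–arc / box /
tilt / cone clauses are inequalities on the fine class and `StraightDatum`. -/
def FlatOutput : Prop :=
  ∀ (N : ℕ) (δd ρd Λd Rwd θd mw : ℝ) (p t : Fin N → EuclideanSpace ℝ (Fin 3)) (γ : Fin N → ℝ) (α : ℝ) (s₀ : Fin N → ℝ),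
    0 < N → 0 < δd → 0 < ρd → 0 < Rwd → 0 < θd → 0 < mw → StraightDatum N δd ρd Λd Rwd θd mw p t γ α s₀ →
    (∀ j k, j ≠ k → |⟪t j, t k⟫_ℝ| ≤ 1 - θd) →
    ∃ (δ ρ K Λ Rw cg θ₀ KA Rb₁ : ℝ), 0 < δ ∧ 0 < ρ ∧ 0 < Rw ∧ 0 < cg ∧ 0 < θ₀ ∧ 0 < Rb₁ ∧ 2 * K * ρ ≤ 1 ∧
      ∀ lam Rb : ℝ, 0 < lam → 0 < Rb → Rb ≤ Rb₁ → ∃ Γ₃ : ℝ, ∀ Γ : ℝ, Γ₃ ≤ Γ →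
        ∀ X : Fin N → ℝ → EuclideanSpace ℝ (Fin 3),
          FineClass Γ δd Λd Rb p t γ α s₀ X → SwitchedTangent Γ ρd lam Rb p t γ α s₀ 1 X → RegularWaist Γ ρd lam Rb p t γ α s₀ 1 X →
          ∃ (w : Fin N → ℝ → ℝ) (c : Fin N → ℝ) (Aa : Fin N → ℝ → ℝ),
            FlatJ1L N δ ρ K Λ Rw Rb cg θ₀ KA Γ γ α X w c Aa ∧ NearStraightJ1G N Λ Rb X w Aa


/-! ## §3 Definition-sanity lemmas (sorry-free) -/

section sanity

/-- at homotopy time 0 the switch weight vanishes identically -/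
theorem switchWeight_zero (ℓ : ℝ) (y : EuclideanSpace ℝ (Fin 3)) : switchWeight ℓ 0 y = 0 := by
  unfold switchWeight switchProfile
  apply Real.smoothTransition.zero_of_nonpos
  have : 0 ≤ ‖y‖ ^ 2 / ℓ ^ 2 := by positivity
  linarith

/-- at homotopy time 1 the switch weight is 1 on the crux ball ‖y‖ ≤ ℓ -/
theorem switchWeight_one_of_mem_ball (ℓ : ℝ) (hℓ : 0 < ℓ) (y : EuclideanSpace ℝ (Fin 3)) (hy : ‖y‖ ≤ ℓ) :
    switchWeight ℓ 1 y = 1 := by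
  unfold switchWeight switchProfile
  apply Real.smoothTransition.one_of_one_le
  have h1 : ‖y‖ ^ 2 ≤ ℓ ^ 2 := by
    exact pow_le_pow_left₀ (norm_nonneg _) hy 2
  have h2 : ‖y‖ ^ 2 / ℓ ^ 2 ≤ 1 := by
    rw [div_le_one (by positivity)]; exact h1
  linarith

/-- at homotopy time 1 the switch weight is 0 beyond radius √2·ℓ -/
theorem switchWeight_zero_of_far (ℓ : ℝ) (hℓ : 0 < ℓ) (y : EuclideanSpace ℝ (Fin 3)) (hy : 2 * ℓ ^ 2 ≤ ‖y‖ ^ 2) :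
    switchWeight ℓ 1 y = 0 := by
  unfold switchWeight switchProfile
  apply Real.smoothTransition.zero_of_nonpos
  have h2 : 2 ≤ ‖y‖ ^ 2 / ℓ ^ 2 := by
    rw [le_div_iff₀ (by positivity)]; linarith
  linarith

/-- at time 1, on the crux ball the switched field IS the true field -/
theorem switchedField_eq_trueField_on_ball {N : ℕ} (Γ ρ lam Rb : ℝ) (p t : Fin N → EuclideanSpace ℝ (Fin 3)) (γ : Fin N → ℝ)
    (α : ℝ) (s₀ : Fin N → ℝ) (X : Fin N → ℝ → EuclideanSpace ℝ (Fin 3)) (y : EuclideanSpace ℝ (Fin 3))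
    (hℓ : 0 < Rb * Real.sqrt (Γ * Real.log Γ)) (hy : ‖y‖ ≤ Rb * Real.sqrt (Γ * Real.log Γ)) :
    switchedField Γ ρ lam Rb p t γ α s₀ 1 X y = trueField Γ γ α X y := by
  unfold switchedField
  rw [switchWeight_one_of_mem_ball _ hℓ y hy]
  simp

/-- at time 0 the switched field IS the outer model (X-independent) -/
theorem switchedField_zero_eq_outer {N : ℕ} (Γ ρ lam Rb : ℝ) (p t : Fin N → EuclideanSpace ℝ (Fin 3)) (γ : Fin N → ℝ)
    (α : ℝ) (s₀ : Fin N → ℝ) (X : Fin N → ℝ → EuclideanSpace ℝ (Fin 3)) (y : EuclideanSpace ℝ (Fin 3)) :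
    switchedField Γ ρ lam Rb p t γ α s₀ 0 X y = outerModel Γ ρ lam p t s₀ y := by
  unfold switchedField
  rw [switchWeight_zero]
  simp

/-- the normal projector kills the axis direction (unit t) -/
theorem perpTo_axis {N : ℕ} (t : Fin N → EuclideanSpace ℝ (Fin 3)) (j : Fin N) (ht : ‖t j‖ = 1) (τ : ℝ) :
    perpTo t j (τ • t j) = 0 := by
  unfold perpTo
  rw [real_inner_smul_left, real_inner_self_eq_norm_sq, ht]
  simp

/-- the tube weight is 1 on the axis of its own tube -/
theorem tubeWeight_axis {N : ℕ} (Γ R : ℝ) (p t : Fin N → EuclideanSpace ℝ (Fin 3)) (s₀ : Fin N → ℝ) (j : Fin N)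
    (ht : ‖t j‖ = 1) (τ : ℝ) :
    tubeWeight Γ R p t s₀ j (waistPt Γ p t s₀ j + τ • t j) = 1 := by
  unfold tubeWeight
  have : waistPt Γ p t s₀ j + τ • t j - waistPt Γ p t s₀ j = τ • t j := by abel
  rw [this, perpTo_axis t j ht τ]
  apply Real.smoothTransition.one_of_one_le
  simp

/-- the arm model on its own axis is the pure axial field (7/4) τ t -/
theorem armModel_axis {N : ℕ} (Γ lam : ℝ) (p t : Fin N → EuclideanSpace ℝ (Fin 3)) (s₀ : Fin N → ℝ) (j : Fin N)
    (ht : ‖t j‖ = 1) (τ : ℝ) :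
    armModel Γ lam p t s₀ j (waistPt Γ p t s₀ j + τ • t j) = ((7/4:ℝ) * τ) • t j := by
  unfold armModel
  have : waistPt Γ p t s₀ j + τ • t j - waistPt Γ p t s₀ j = τ • t j := by abel
  rw [this, perpTo_axis t j ht τ, real_inner_smul_left, real_inner_self_eq_norm_sq, ht]
  simp

end sanity

end Summit.NavierStokesRegularity.NavierStokesRegularity.Cruxes.SkeletonJ1R.SwitchoffDegreeRSanity

end
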